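import Literature.Combinatorics.Optimization.TracialDesigns
import Literature.Combinatorics.Optimization.PsdFactorNorms
import HarnessLib

/-!
# The tracial hyperplane bound at the printed exponent (sharp Briët–Dadush–Pokutta rescaling)

Everything here is PROVED (no named facts). This module upgrades the two "weak form" statements of
`Literature.Combinatorics.Optimization.PsdFactorizationRescaling` / `…TracialDesigns` — which lose one
factor of the dimension `r` because they use an elementary Auerbach-basis rescaling
(`HasPsdFactorization.rescale_weak`: `M = r²Δ·Tr(X_i Y_j)`) — to the PRINTED constants, now that the
sharp rescaling theorem is a tree theorem
(`Literature.Combinatorics.Optimization.FawziEtAl2015_cor68_holds`, John's-ellipsoid form of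
Briët–Dadush–Pokutta [cite: BrietDadushPokutta2014, Thm. 6 (§3, p. 7)] = [cite: FawziEtAl2015, Cor. 6.8 (§6.2, p19)]:
a size-`r` psd factorization of `M ≤ Δ` can be chosen with BOTH factor families of operator norm `≤ √(rΔ)`):

* `HasPsdFactorization.rescale_sharp` — `M_{ij} = r·Δ·Tr(X_i Y_j)` with `0 ⪯ X_i ⪯ I`, `0 ⪯ Y_j ⪯ I` of size `r`
  (the weak form has `r²Δ`);
* `HasPsdFactorization.weightedSum_le_of_psdRect_sharp` — the `r`-dimensional hyperplane-separation
  bound `⟨W, M⟩ ≤ r²·Δ·γ` whenever every psd rectangle of dimension `r` supported off the zeros of `M` has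
  `Σ W_{ij} Tr(X_i Y_j) ≤ r·γ` (weak form: `r³`), the psd analogue of Rothvoß's
  `xc ≥ ⟨W,S⟩/(‖S‖_∞ · max_R ⟨W,R⟩)` [cite: Rothvoss2017, §2 (PDF pp. 6–7)];
* `tracialHyperplaneBound_two` — for the odd-cut slack-matrix currency of `…TracialDesigns`
  (`TracialValueLEAt W γ r`, tight pairs `cc U M = 1`): `⟨W, S⟩ ≤ r²·Δ·γ`, i.e. the named statement
  `TracialHyperplaneBoundAt` at its printed exponent `p = 2` (the tree's `tracialHyperplaneBoundAt_holds`
  witnesses `p = 3`); `tracialHyperplaneBoundAt_of_two` re-derives the named `∃ p` statement from it.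

Kept in a separate module so that the import closure of `…TracialDesigns` (the route file and the kernel
rung files import it) does not acquire `…PsdFactorNorms`.
-/

noncomputable section

open Matrix Finset
open scoped MatrixOrder

namespace Literature.Combinatorics.Optimization

open Literature.Computation.Certificates.SemidefiniteComplementarity
open Literature.Barriers.PneNP

section Rescale

variable {ι κ : Type} [Fintype ι] [Fintype κ]

/-- **Briët–Dadush–Pokutta rescaling of psd factorizations — sharp (printed) form.** If `M ≤ Δ` entrywise
(`0 < Δ`) has a psd factorization of size `r ≥ 1`, then `M_{ij} = r·Δ·Tr(X_i Y_j)` with `0 ⪯ X_i ⪯ I` and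
`0 ⪯ Y_j ⪯ I`, all of size `r`: divide the `√(rΔ)`-bounded factors of
`FawziEtAl2015_cor68_holds` by `√(rΔ)`.
[cite: BrietDadushPokutta2014, Thm. 6 (§3, p. 7)] [cite: FawziEtAl2015, Cor. 6.8 (§6.2, p19)] -/
theorem HasPsdFactorization.rescale_sharp {M : ι → κ → ℝ} {r : ℕ} {Δ : ℝ} (hΔ : 0 < Δ) (hr : 0 < r)
    (hM : ∀ i j, M i j ≤ Δ) (h : HasPsdFactorization M r) :
    ∃ (X : ι → Matrix (Fin r) (Fin r) ℝ) (Y : κ → Matrix (Fin r) (Fin r) ℝ),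
      (∀ i, (X i).PosSemidef ∧ (1 - X i).PosSemidef) ∧
      (∀ j, (Y j).PosSemidef ∧ (1 - Y j).PosSemidef) ∧
      ∀ i j, M i j = (r : ℝ) * Δ * (X i * Y j).trace := by
  classical
  obtain ⟨A, B, hA, hB, hMAB, hAle, hBle⟩ := FawziEtAl2015_cor68_holds ι κ M r Δ hM h
  have hr' : (0 : ℝ) < r := by exact_mod_cast hr
  set s : ℝ := Real.sqrt (r * Δ) with hs
  have hs0 : 0 < s := Real.sqrt_pos.2 (by positivity)
  have hs2 : s * s = r * Δ := by
    rw [hs, Real.mul_self_sqrt (by positivity)]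
  -- `s⁻¹ • (s • 1 - C) = 1 - s⁻¹ • C`
  have hsub : ∀ C : Matrix (Fin r) (Fin r) ℝ, s⁻¹ • (s • (1 : Matrix (Fin r) (Fin r) ℝ) - C) =
      1 - s⁻¹ • C := fun C => by
    rw [smul_sub, smul_smul, inv_mul_cancel₀ hs0.ne', one_smul]
  refine ⟨fun i => s⁻¹ • A i, fun j => s⁻¹ • B j, fun i => ⟨(hA i).smul (inv_pos.2 hs0).le, ?_⟩,
    fun j => ⟨(hB j).smul (inv_pos.2 hs0).le, ?_⟩, fun i j => ?_⟩
  · rw [← hsub]; exact (hAle i).smul (inv_pos.2 hs0).le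
  · rw [← hsub]; exact (hBle j).smul (inv_pos.2 hs0).le
  · rw [hMAB i j, Matrix.smul_mul, Matrix.mul_smul, smul_smul, trace_smul, smul_eq_mul, ← hs2]
    field_simp

/-- **Hyperplane-separation lower bound for psd rank — printed constant.** If `M ≤ Δ` entrywise
(`0 ≤ Δ`) has a psd factorization of size `r` and every PSD RECTANGLE `(X, Y)` of dimension `r` —
`0 ⪯ X_i ⪯ I`, `0 ⪯ Y_j ⪯ I`, `X_i Y_j = 0` wherever `M_{ij} = 0` — has `Σ_{ij} W_{ij} Tr(X_i Y_j) ≤ r·γ`,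
then `⟨W, M⟩ ≤ r²·Δ·γ` (the tree's `…weightedSum_le_of_psdRect` has `r³`). So a weight `W` with
`⟨W, M⟩ = 1` whose tracial value per dimension is `≤ γ` certifies `rk_psd(M) ≥ (Δγ)^{-1/2}`.
[cite: Rothvoss2017, §2 (PDF pp. 6–7)] [cite: BrietDadushPokutta2014, Thm. 6 (§3, p. 7)]
[cite: FawziEtAl2015, Cor. 6.8 (§6.2, p19)] -/
theorem HasPsdFactorization.weightedSum_le_of_psdRect_sharp {M W : ι → κ → ℝ} {r : ℕ} {Δ γ : ℝ}
    (hΔ : 0 ≤ Δ) (hM : ∀ i j, M i j ≤ Δ) (h : HasPsdFactorization M r)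
    (hW : ∀ (X : ι → Matrix (Fin r) (Fin r) ℝ) (Y : κ → Matrix (Fin r) (Fin r) ℝ),
      (∀ i, (X i).PosSemidef ∧ (1 - X i).PosSemidef) →
      (∀ j, (Y j).PosSemidef ∧ (1 - Y j).PosSemidef) →
      (∀ i j, M i j = 0 → X i * Y j = 0) →
      ∑ i, ∑ j, W i j * (X i * Y j).trace ≤ r * γ) :
    ∑ i, ∑ j, W i j * M i j ≤ (r : ℝ) ^ 2 * Δ * γ := by
  classical
  have hM0 : ∀ i j, 0 ≤ M i j := h.entry_nonneg
  rcases Nat.eq_zero_or_pos r with rfl | hr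
  · -- `r = 0`: every entry is a `0 × 0` trace
    obtain ⟨A, B, -, -, hMAB⟩ := h
    have hM00 : ∀ i j, M i j = 0 := fun i j => by rw [hMAB]; simp [Matrix.trace]
    simp [hM00]
  have hr' : (0 : ℝ) < r := by exact_mod_cast hr
  -- `γ ≥ 0` from the zero rectangle
  have hγ : 0 ≤ γ := by
    have := hW (fun _ => 0) (fun _ => 0) (fun _ => ⟨PosSemidef.zero, by simpa using PosSemidef.one⟩)
      (fun _ => ⟨PosSemidef.zero, by simpa using PosSemidef.one⟩) (fun _ _ _ => Matrix.zero_mul _)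
    simp only [trace_zero, mul_zero, sum_const_zero] at this
    nlinarith
  rcases hΔ.eq_or_lt with hΔ0 | hΔpos
  · -- `Δ = 0`: `M = 0`
    have hM00 : ∀ i j, M i j = 0 := fun i j => le_antisymm (hΔ0 ▸ hM i j) (hM0 i j)
    simp [hM00, ← hΔ0]
  obtain ⟨X, Y, hX, hY, hMXY⟩ := h.rescale_sharp hΔpos hr hM
  have hzero : ∀ i j, M i j = 0 → X i * Y j = 0 := by
    intro i j hij
    rw [hMXY i j] at hij
    have htr : (X i * Y j).trace = 0 := by
      rcases mul_eq_zero.1 hij with h0 | h0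
      · exact absurd h0 (by positivity)
      · exact h0
    exact (trace_mul_eq_zero_iff (hX i).1 (hY j).1).1 htr
  have hsum := hW X Y hX hY hzero
  calc ∑ i, ∑ j, W i j * M i j = (r : ℝ) * Δ * ∑ i, ∑ j, W i j * (X i * Y j).trace := by
        simp_rw [hMXY, mul_sum]
        exact sum_congr rfl fun i _ => sum_congr rfl fun j _ => by ring
    _ ≤ (r : ℝ) * Δ * (r * γ) := by gcongr
    _ = (r : ℝ) ^ 2 * Δ * γ := by ring

end Rescale

/-! ### The odd-cut slack currency: `TracialHyperplaneBoundAt` at `p = 2` -/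

/-- **The tracial hyperplane bound with the printed loss exponent `p = 2`.** If `S ≤ Δ` entrywise
(`0 ≤ Δ`) on (odd sets) × (perfect matchings) of `K_n` vanishes on the tight pairs `cc U M = 1` and has a
psd factorization of size `r`, then every weight matrix `W` of tracial value `≤ γ` in dimension `r`
(`TracialValueLEAt W γ r`) has `⟨W, S⟩ ≤ r²·Δ·γ` — the Briët–Dadush–Pokutta rescaling gives factors of
operator norm `≤ √(rΔ)`, so `S = rΔ·tr(X_U Y_M)` on a psd rectangle of dimension `r`, whence
`⟨W, S⟩ ≤ rΔ·(rγ)`. The tree's `tracialHyperplaneBoundAt_holds` proves the named `∃ p` statement with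
`p = 3` (Auerbach form); this is the constant in print.
[cite: BrietDadushPokutta2014, Thm. 6 (§3, p. 7)] [cite: FawziEtAl2015, Cor. 6.8 (§6.2, p19)]
[cite: Rothvoss2017, §2 (PDF pp. 6–7)] -/
theorem tracialHyperplaneBound_two (n r : ℕ) (S W : OddSet n → PMatch n → ℝ) (Δ γ : ℝ)
    (hΔ : 0 ≤ Δ) (hS : ∀ U M, S U M ≤ Δ) (hcc : ∀ U M, cc U M = 1 → S U M = 0)
    (hW : TracialValueLEAt W γ r) (hfac : HasPsdFactorization S r) :
    (∑ U, ∑ M, W U M * S U M) ≤ (r : ℝ) ^ 2 * Δ * γ := by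
  refine HasPsdFactorization.weightedSum_le_of_psdRect_sharp hΔ hS hfac fun X Y hX hY hzero => ?_
  have hrect : IsPsdRect X Y := ⟨hX, hY, fun U M h1 => hzero U M (hcc U M h1)⟩
  have h := hW X Y hrect
  rcases Nat.eq_zero_or_pos r with rfl | hr
  · simp [Matrix.trace]
  · have hr' : (0 : ℝ) < r := by exact_mod_cast hr
    calc ∑ U, ∑ M, W U M * (X U * Y M).trace ≤ γ * r := (div_le_iff₀ hr').1 h
      _ = r * γ := mul_comm _ _

/-- The named statement `TracialHyperplaneBoundAt` re-derived from the `p = 2` bound (for the record: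
`tracialHyperplaneBoundAt_holds` proves the same `Prop` with the witness `p = 3`).
[cite: BrietDadushPokutta2014, Thm. 6 (§3, p. 7)] -/
theorem tracialHyperplaneBoundAt_of_two : TracialHyperplaneBoundAt :=
  ⟨2, fun n r S W Δ γ hΔ hS hcc hW hfac => tracialHyperplaneBound_two n r S W Δ γ hΔ hS hcc hW hfac⟩

end Literature.Combinatorics.Optimization

end
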